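import Mathlib
import Summits.AtomisticToContinuum.HydrodynamicLimit.Theorems.ImplosionDichotomyDenseExcursionSonicCavityDefs

/-!
# The characteristic rows of the linearised radial operator and the order-0 sonic relation
# (crux `DenseExcursion`, line `sonic-cavity-renewal`, helpers for stub `stub_sonicConfinement`)

Helper file (`--supports stmt-AtomisticToContinuum-12586`, line lead a2, stub-worker for `stub_sonicConfinement`).

The linearised radial operator `L = (linW, linS)` (`…R2Modes`) reads `L v = A v′ + B v` with
`A = [[W−1, 3S],[S/3, W−1]]`, `B = [[W′+2W−r, 3S′+6S],[S′+2S, W′/3+2W−r]]`, `v = (ŵ, ŝ)`, `x = log(radius)`.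
The principal symbol `A` has the characteristic speeds `(W−1) ± S` with LEFT eigen-rows `ℓ₊ = (1, 3)`, `ℓ₋ = (1, −3)`:

* `lin_characteristic_rows` (pure algebra, every `x`):
  `linW + 3·linS = ((W−1)+S)·(ŵ′ + 3ŝ′) + (order-0 terms)`, `linW − 3·linS = ((W−1)−S)·(ŵ′ − 3ŝ′) + (order-0 terms)`;
* `sonic_order_zero` (registered helper): at the sonic point `x = 0`, where `W 0 + S 0 = 1`, the degenerate row `ℓ₊ A(0)` vanishes, so
  every `C¹` solution of the mode equations `Λ ŵ = linW`, `Λ ŝ = linS` satisfies the DERIVATIVE-FREE relation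
  `Λ (ŵ 0 + 3 ŝ 0) = ℓ₊ B(0) v(0)`, i.e. `ℓ₊ (B(0) − Λ) v(0) = 0`.
  This is the order-0 input of the `|Im Λ|`-confinement mechanism (`stub_sonicConfinement`): it pins the ratio of the two characteristic
  components of a sonic-smooth solution at `x = 0` to `v₋/v₊ = (6Λ − ℓ₊B(0)e₊)/(ℓ₊B(0)e₋)` (numerically `(6Λ − 8.1731)/6.3345` on `SS(r₂)`),
  so the smooth branch is asymptotically pure outgoing (`+` family) as `|Λ| → ∞`.

Sources: Chen–Shkoller–Vicol arXiv:2605.00808 §1.10 (outgoing architecture at a repulsive sonic point); Biasi 2021 §3.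
NOT here: the stub `stub_sonicConfinement` itself (needs an effective Levinson diagonalisation + centre matching; see the worker report).
-/

noncomputable section

namespace Summit.AtomisticToContinuum.HydrodynamicLimit.Theorems.SonicCavityRenewal

open Summit.AtomisticToContinuum.HydrodynamicLimit.Theorems.R2OneModeTwoConditions

/-- THE CHARACTERISTIC ROWS of `L = (linW, linS)`: applying the left eigen-rows `ℓ₊ = (1,3)`, `ℓ₋ = (1,−3)` of the principal symbol
`A = [[W−1, 3S],[S/3, W−1]]` diagonalises the first-order part — `linW ± 3 linS = ((W−1) ± S)·(ŵ′ ± 3ŝ′) + (order-0 terms)` at every `x`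
(pure algebra). [folklore] -/
theorem lin_characteristic_rows : ∀ (r : ℝ) (W S : ℝ → ℝ) (ŵ ŝ : ℝ → ℂ) (x : ℝ),
    linW r W S ŵ ŝ x + 3 * linS r W S ŵ ŝ x =
        ((W x - 1 + S x : ℝ) : ℂ) * (deriv ŵ x + 3 * deriv ŝ x) +
          ((deriv W x + 2 * W x - r + 3 * (deriv S x + 2 * S x) : ℝ) : ℂ) * ŵ x +
          ((3 * deriv S x + 6 * S x + 3 * (deriv W x / 3 + 2 * W x - r) : ℝ) : ℂ) * ŝ x ∧
      linW r W S ŵ ŝ x - 3 * linS r W S ŵ ŝ x =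
        ((W x - 1 - S x : ℝ) : ℂ) * (deriv ŵ x - 3 * deriv ŝ x) +
          ((deriv W x + 2 * W x - r - 3 * (deriv S x + 2 * S x) : ℝ) : ℂ) * ŵ x +
          ((3 * deriv S x + 6 * S x - 3 * (deriv W x / 3 + 2 * W x - r) : ℝ) : ℂ) * ŝ x := by
  intro r W S ŵ ŝ x
  unfold linW linS
  push_cast
  constructor <;> ring

/-- **THE ORDER-0 SONIC RELATION** (registered helper `sonic_order_zero` for `stub_sonicConfinement`). At the sonic point `x = 0`
(`W 0 + S 0 = 1`) the degenerate characteristic row `ℓ₊ A(0)`, `ℓ₊ = (1, 3)`, of the principal symbol vanishes, so the mode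
equations `Λ ŵ 0 = linW … 0`, `Λ ŝ 0 = linS … 0` imply the derivative-free relation
`Λ (ŵ 0 + 3 ŝ 0) = (W′(0) + 2W(0) − r + 3(S′(0) + 2S(0)))·ŵ 0 + (3S′(0) + 6S(0) + 3(W′(0)/3 + 2W(0) − r))·ŝ 0`, i.e.
`ℓ₊ (B(0) − Λ) v(0) = 0`: the derivative terms of `linW + 3 linS` carry the total coefficient `(W 0 − 1 + S 0)·(ŵ′ 0 + 3 ŝ′ 0) = 0`.
(On `SS(r₂)`: `ℓ₊B(0)e₊ = 8.1731`, `ℓ₊B(0)e₋ = 6.3345`, so a sonic-smooth solution has `v₋/v₊ = (6Λ − 8.1731)/6.3345` at `x = 0`.)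
[folklore] -/
theorem sonic_order_zero : ∀ (r : ℝ) (W S : ℝ → ℝ) (Λ : ℂ) (ŵ ŝ : ℝ → ℂ), W 0 + S 0 = 1 → (Λ * ŵ 0 = linW r W S ŵ ŝ 0 ∧ Λ * ŝ 0 = linS r W S ŵ ŝ 0) → Λ * (ŵ 0 + 3 * ŝ 0) = ((deriv W 0 + 2 * W 0 - r + 3 * (deriv S 0 + 2 * S 0) : ℝ) : ℂ) * ŵ 0 + ((3 * deriv S 0 + 6 * S 0 + 3 * (deriv W 0 / 3 + 2 * W 0 - r) : ℝ) : ℂ) * ŝ 0 := by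
  intro r W S Λ ŵ ŝ h0 hmode
  obtain ⟨h1, h2⟩ := hmode
  have hc : ((W 0 : ℝ) : ℂ) + ((S 0 : ℝ) : ℂ) = 1 := by exact_mod_cast h0
  unfold linW at h1
  unfold linS at h2
  push_cast at h1 h2 ⊢
  linear_combination h1 + 3 * h2 + (deriv ŵ 0 + 3 * deriv ŝ 0) * hc

/-- The order-0 sonic relation for a smooth radial MODE of a profile with its sonic point at `x = 0` (the form consumed downstream:
hypotheses `IsSmoothRadialMode` and the first conjunct of `CavityTube`). [folklore] -/
theorem sonic_order_zero_of_mode {r : ℝ} {W S : ℝ → ℝ} {Λ : ℂ} {ŵ ŝ : ℝ → ℂ} (h0 : W 0 + S 0 = 1)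
    (hm : IsSmoothRadialMode r W S Λ ŵ ŝ) :
    Λ * (ŵ 0 + 3 * ŝ 0) =
      ((deriv W 0 + 2 * W 0 - r + 3 * (deriv S 0 + 2 * S 0) : ℝ) : ℂ) * ŵ 0 +
        ((3 * deriv S 0 + 6 * S 0 + 3 * (deriv W 0 / 3 + 2 * W 0 - r) : ℝ) : ℂ) * ŝ 0 :=
  sonic_order_zero r W S Λ ŵ ŝ h0 (hm.2.2 0)

end Summit.AtomisticToContinuum.HydrodynamicLimit.Theorems.SonicCavityRenewal

end
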